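/-
Copyright: the b2b-balaban T⁴-continuum CRUX team, row NE7b leaf lineage `t4-ne7b-formalise-leaf-05` (gen 161). Project licence.
-/
import Summits.QuantumFields.BalabanUV.T4Continuum.Spine.NE7b.BlockAverageTower
import Summits.QuantumFields.BalabanUV.T4Continuum.Spine.NE7b.HardStepSandwichTower
import Summits.QuantumFields.BalabanUV.T4Continuum.Spine.NE7b.BlockAverageSectionNorm

/-!
# THE SANDWICHED (INTERACTING QUADRATIC) TOWER IS LETTERED UNIFORMLY IN THE LEVEL — ANY symmetric form `W_k` with
# `γ₀·R_k ≤ W_k ≤ γ₁·R_k` on the finest torus flows, along ITS OWN critical sections of `Q′_L` with print's rescaling `L^{2−d}`,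
# between `γ₀·V_j` and `γ₁·V_j` (the free tower) AT EVERY LEVEL — hence `γ₀·R_j ≤ W_j ≤ γ₁·γ₁(d)·R_j` and the floor `γ₀·2∕L²` with
# the SAME constants at every level of every height: BAUB §4's one-step sandwich made `k`-uniform (row NE7b, node U5c;
# [folklore] over leaf-06's HSMO `transported_sandwich`, leaf-03's QFM and this lineage's BATW BY NAME)

Cell `pub-balaban`, sub-cell `t4`, spine estimate NE7b (`T4WeightBudget.RelWeightBound`; the cell's OWN estimate — NOT PRINTED in
[Bałaban 1983–89], NOT PROVED).  Crux-route work under `Spine/NE7b/` by a row leaf (`t4-ne7b-formalise-leaf-05` gen 161) under FREEZE (0)'s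
crux-prover clause; the tenth file of this lineage's hard-flow packet.  NOTHING of Bałaban's is asserted; no `T4Continuum/Support` leaf
typed; no `def` (towers are EXISTENTIAL outputs pinned by their recursion equations); zero `sorry`.

WHY (located).  PRICING-NE7b v134 §3 lists for the hard-flow sub-limb (V): «the interacting-form sandwich HERE» — ONE step (BAUB
`interacting_ineq167_of_sandwich`: `γ₀·Q ≤ V ≤ γ₁·Q ⟹ γ₀·R ≤ V⁺ ≤ γ₁·γ₁(d)·R`).  Iterating that statement naively feeds `V⁺`'s letters
`(γ₀, γ₁γ₁(d))` back in as the next sandwich and MULTIPLIES: `γ₁(d)^k` after `k` steps.  The repair is leaf-06's monotonicity of the hard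
step (HSMO `transported_sandwich`: `γ₀·P ≤ Q ≤ γ₁·P ⟹ γ₀·P⁺ ≤ Q⁺ ≤ γ₁·P⁺`, SAME constants) run ALONGSIDE the free tower of BATW: the
interacting tower stays between `γ₀·`(free tower) and `γ₁·`(free tower) at every level, and the free tower's letters are level-free
(BATW `exists_tower`).  the abstract part (any Hilbert fibres, any blockings with continuous right inverses, any rescaling `c ≥ 0`) is HSST;
this file is print's torus.

WHAT IS PROVED ([folklore]; the abstract step ∕ tower are this lineage's `…HardStepSandwichTower` (HSST: `sandwich_step`,
`nextStep_of_sandwich`, `exists_sandwich_tower_abstract` — HSMO `transported_sandwich` + QFM under an induction with a shift of the fibre family),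
the unit form's symmetry ∕ positivity are `…BlockAverageSectionNorm` (BASN), both BY NAME):
* **`exists_sandwich_tower`** (print's torus): for every level family `N (j+1) = fine L (N j)` (through `recast`), unit Dirichlet forms `R j`,
  block averages `D j = re Q′_L`, every `k ≥ 1` and every symmetric `W_k` on `Tor (N k)` with `γ₀·R k ≤ W_k ≤ γ₁·R k` (`0 < γ₀`, `0 ≤ γ₁`): the
  free tower `(V, H)` of BATW and the interacting tower `(W, T)` exist together, and for every `j < k`: **`γ₀·R j g g ≤ W j g g ≤ γ₁·gamma1 d·R j g g`**,
  floor `W (j+1) ≥ γ₀·(2∕L²)` on `ker D j`, `γ₀·V j ≤ W j ≤ γ₁·V j` — constants free of `j`, `k`, the volume; toy.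

NOT HERE (honest): non-quadratic (non-linear) actions — the sandwich tower is the GAUSSIAN-with-variable-coefficients case (e.g. a
fluctuation form dominated by and dominating the free one), not Bałaban's small-field effective action; `U ≠ 1` covariant forms enter only
IF someone proves their sandwich against the free form (not claimed); the VECTOR law (1.17); `ℓ²(ℤ^d)`; (A3) ∕ (A1c), NC-NE7b-α UNRULED;
constants by value.  BY-NAME EFFECT ON THE WALL: NONE (uniform letters for sandwiched quadratic towers; the wall is (R2)).  NE7b NOT
PRINTED ∕ NOT PROVED; spine PROVED 0∕9; rung (B)+1 on a FINITE torus — NOT infinite volume, NOT the mass gap, NOT Clay.  HONEST DEPENDENCY: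
continuum YM on T⁴ ⇐ BetaPertH ∧ nine spine estimates (0∕9 proved); BetaPertH ⇐ (D1) ∧ (D4) ∧ CAP+tail; G-an2-4 gates asym, D1 and NE2∕3∕4.
-/
set_option autoImplicit false

namespace Summit.QuantumFields.BalabanUV.T4Continuum.NE7b.BlockAverageSandwichTower

open Matrix WithLp Finset
open Literature.MathematicalPhysics.QuantumFieldTheory.Balaban1983to89
open B5Prop11Plancherel (Tor fine)
open B5Action121 (GradOp)
open B5Block118 (QsOp)
open B5RealFields (reM)
open B5Composition116 (recast)
open B5Ineq167UpperZd (gamma1)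
open Summit.QuantumFields.BalabanUV.T4Continuum.NE7b.HardStepSandwichTower (exists_sandwich_tower_abstract)
open Summit.QuantumFields.BalabanUV.T4Continuum.NE7b.BlockAverageSectionNorm (unitForm_symm unitForm_nonneg)
open Summit.QuantumFields.BalabanUV.T4Continuum.NE7b.BlockAverageTower (exists_tower)
/-! ## Print's torus: the sandwiched tower alongside BATW's free tower -/

section Torus

variable {d : ℕ} (L : ℕ) [NeZero L]

/-- **THE SANDWICHED TOWER ON PRINT's TORI, LETTERED UNIFORMLY IN THE LEVEL.**  For every level family `N (j+1) = fine L (N j)` (through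
`recast`), unit Dirichlet forms `R j`, block averages `D j = re Q′_L`, every `k ≥ 1`, and every symmetric form `W_k` on `Tor (N k)` with
`γ₀·R k ≤ W_k ≤ γ₁·R k` (`0 < γ₀`, `0 ≤ γ₁`): the free tower `(V, H)` (BATW `exists_tower`) and the interacting tower `(W, T)`
(`W j = (L²∕L^d)•(W (j+1)).bilinearComp (T j) (T j)` along THE `W (j+1)`-critical section of `D j`) exist, and for every `j < k`:
**`γ₀·R j g g ≤ W j g g ≤ γ₁·gamma1 d·R j g g`** and `D j g = 0 ⟹ γ₀·(2∕L²)‖g‖² ≤ W (j+1) g g` — the same constants at every level of every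
height; and `γ₀·V j ≤ W j ≤ γ₁·V j` for every `j ≤ k`. [folklore] -/
theorem exists_sandwich_tower (k : ℕ) (hk : 1 ≤ k) {γ₀ γ₁ : ℝ} (hγ₀ : 0 < γ₀) (hγ₁ : 0 ≤ γ₁) :
    ∀ (N : ℕ → Fin d → ℕ) [∀ j μ, NeZero (N j μ)] (e : ∀ j, fine L (N j) = N (j + 1))
      (R : ∀ j, EuclideanSpace ℝ (Tor (N j)) →L[ℝ] EuclideanSpace ℝ (Tor (N j)) →L[ℝ] ℝ)
      (D : ∀ j, EuclideanSpace ℝ (Tor (N (j + 1))) →L[ℝ] EuclideanSpace ℝ (Tor (N j)))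
      (Wk : EuclideanSpace ℝ (Tor (N k)) →L[ℝ] EuclideanSpace ℝ (Tor (N k)) →L[ℝ] ℝ),
      (∀ j g h, R j g h = ofLp g ⬝ᵥ (((reM (GradOp (N j) 1))ᵀ * reM (GradOp (N j) 1)) *ᵥ ofLp h)) →
      (∀ j x, ofLp (D j x) = reM (QsOp L (N j)) *ᵥ fun z => ofLp x (recast (congrFun (e j)) z)) →
      (∀ g h, Wk g h = Wk h g) → (∀ g, γ₀ * R k g g ≤ Wk g g) → (∀ g, Wk g g ≤ γ₁ * R k g g) →
      ∃ (V : ∀ j, EuclideanSpace ℝ (Tor (N j)) →L[ℝ] EuclideanSpace ℝ (Tor (N j)) →L[ℝ] ℝ)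
        (H : ∀ j, EuclideanSpace ℝ (Tor (N j)) →L[ℝ] EuclideanSpace ℝ (Tor (N (j + 1))))
        (W : ∀ j, EuclideanSpace ℝ (Tor (N j)) →L[ℝ] EuclideanSpace ℝ (Tor (N j)) →L[ℝ] ℝ)
        (T : ∀ j, EuclideanSpace ℝ (Tor (N j)) →L[ℝ] EuclideanSpace ℝ (Tor (N (j + 1)))),
        V k = R k ∧ W k = Wk ∧
        (∀ j, j < k → (∀ g, D j (H j g) = g) ∧ (∀ g κ, D j κ = 0 → V (j + 1) (H j g) κ = 0) ∧
          V j = ((L : ℝ) ^ 2 / (L : ℝ) ^ d) • (V (j + 1)).bilinearComp (H j) (H j)) ∧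
        (∀ j, j < k → (∀ g, D j (T j g) = g) ∧ (∀ g κ, D j κ = 0 → W (j + 1) (T j g) κ = 0) ∧
          W j = ((L : ℝ) ^ 2 / (L : ℝ) ^ d) • (W (j + 1)).bilinearComp (T j) (T j)) ∧
        (∀ j, j < k → ∀ T' : EuclideanSpace ℝ (Tor (N j)) →L[ℝ] EuclideanSpace ℝ (Tor (N (j + 1))),
          (∀ g, D j (T' g) = g) → (∀ g κ, D j κ = 0 → W (j + 1) (T' g) κ = 0) → T' = T j) ∧
        (∀ j, j < k → ∀ g, D j g = 0 → γ₀ * (2 / (L : ℝ) ^ 2) * ‖g‖ ^ 2 ≤ W (j + 1) g g) ∧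
        (∀ j, j ≤ k → (∀ g, γ₀ * V j g g ≤ W j g g) ∧ (∀ g, W j g g ≤ γ₁ * V j g g)) ∧
        (∀ j, j < k → ∀ g, γ₀ * R j g g ≤ W j g g ∧ W j g g ≤ γ₁ * gamma1 d * R j g g) := by
  intro N _ e R D Wk hR hD hWsym hlo hhi
  obtain ⟨V, H, htop, hrec, hfloor, -, hsp, h167, -⟩ := exists_tower L k hk N e R D hR hD
  have hc : (0 : ℝ) ≤ (L : ℝ) ^ 2 / (L : ℝ) ^ d := by positivity
  have hm : (0 : ℝ) < 2 / (L : ℝ) ^ 2 := by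
    have hL : (0 : ℝ) < L := by exact_mod_cast Nat.pos_of_ne_zero (NeZero.ne L)
    positivity
  -- every free level form is symmetric and `≥ 0`: below the top by BATW, at the top it is `R k`
  have hsym : ∀ j, j ≤ k → (∀ g h, V j g h = V j h g) ∧ (∀ g, 0 ≤ V j g g) := fun j hj => by
    rcases Nat.lt_or_ge j k with hjk | hjk
    · exact hsp j hjk
    · obtain rfl : j = k := le_antisymm hj hjk
      rw [htop]
      exact ⟨unitForm_symm (hR j), unitForm_nonneg (hR j)⟩
  have hlo' : ∀ g, γ₀ * V k g g ≤ Wk g g := fun g => by rw [htop]; exact hlo g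
  have hhi' : ∀ g, Wk g g ≤ γ₁ * V k g g := fun g => by rw [htop]; exact hhi g
  obtain ⟨W, T, hWtop, hWrec, hWuniq, hWfl, hsand⟩ :=
    exists_sandwich_tower_abstract hc hγ₀ hm k (fun j => EuclideanSpace ℝ (Tor (N j))) D V H Wk hrec hfloor hsym hWsym hlo' hhi'
  refine ⟨V, H, W, T, htop, hWtop, hrec, hWrec, hWuniq, hWfl, fun j hj => ⟨(hsand j hj).1, (hsand j hj).2.1⟩, fun j hj g => ?_⟩
  obtain ⟨hl, hh, -⟩ := hsand j hj.le
  obtain ⟨hRV, hVR⟩ := h167 j hj g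
  constructor
  · calc γ₀ * R j g g ≤ γ₀ * V j g g := mul_le_mul_of_nonneg_left hRV hγ₀.le
      _ ≤ W j g g := hl g
  · calc W j g g ≤ γ₁ * V j g g := hh g
      _ ≤ γ₁ * (gamma1 d * R j g g) := mul_le_mul_of_nonneg_left hVR hγ₁
      _ = γ₁ * gamma1 d * R j g g := by ring

/-- Toy: the sandwiched letters at `d = 4`, `L = 2`, `γ₀ = 1∕2`, `γ₁ = 2` are `(γ₀, γ₁·gamma1 4) = (1∕2, 429 981 700)` and the floor is
`γ₀·2∕L² = 1∕4` at EVERY level — where the one-step statement iterated `k` times would display `2·gamma1 4 ^ k`. -/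
example : (2 : ℝ) * (2 + 8 * 4 ^ 2 * 36 ^ 4) = 429981700 ∧ (1 / 2 : ℝ) * (2 / (2 : ℕ) ^ 2) = 1 / 4 := by norm_num

end Torus

end Summit.QuantumFields.BalabanUV.T4Continuum.NE7b.BlockAverageSandwichTower
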